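import Mathlib.Combinatorics.SetFamily.LYM
import Literature.Computability.AlgebraicComplexity.LocalStrongUSP

/-!
# ω-census, family (b1): a kernel CEILING for local puzzles — Sperner's bound

HONEST FRAMING (pub-omega census; verbatim): lottery ticket; floor = certified bounds/negative ranges.

Negative-range bookkeeping for the local-puzzle sub-families (b1-S)/(b1-U) of the ω census: in a local USP (every
ordered triple of rows, not all equal, hits `L ∪ {(1,2,3)}` in some column; a fortiori in a local STRONG USP, tree
`IsLocalStrongUSP`) the index triples `(a, a, c)`, `a ≠ c`, can only hit the patterns `(1,1,3)`, `(2,2,3)`: some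
column has `c`-entry `3` and `a`-entry `≠ 3`.  Hence the `3`-supports of the rows are pairwise `⊄`, i.e. distinct and
an antichain in the Boolean lattice of the `k` columns, and **Sperner's theorem** (Mathlib `IsAntichain.sperner`)
bounds the number of rows by `C(k, ⌊k/2⌋)` (`card_le_choose_half_of_localUSP`, `IsLocalStrongUSP.card_le_choose_half`).
This is the ceiling against which the SAT census maxima (k ≤ 9: local-SUSP 2,2,3,4,6,…; local-USP 2,2,5,6,…) are
read; it is far from tight but it is the kernel-certified statement that local puzzles of width `k` are
polynomially fewer than `3^k`-row puzzles could be (and, with `C(k,⌊k/2⌋) ≤ 2^k`, that their ω-rows can never reach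
the `2^{k}`-type sizes of CKSU Prop. 11 at the same width).
-/

open Finset
open Literature.Computability.AlgebraicComplexity

namespace Summit.MatrixMultiplication.OmegaCensus

/-- Pattern bookkeeping (finite check): a pattern of `L ∪ {(1,2,3)}` whose first two symbols agree is `(1,1,3)` or
`(2,2,3)` — its third symbol is `3` and its first is not (symbols coded `0,1,2`). [folklore] -/
theorem localUSPPattern_eq_cases :
    ∀ p ∈ insert ((0 : Fin 3), (1 : Fin 3), (2 : Fin 3)) localStrongUSPPatterns,
      p.1 = p.2.1 → p.2.2 = 2 ∧ p.1 ≠ 2 := by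
  unfold localStrongUSPPatterns
  decide

/-- **Sperner ceiling for local USPs.** If every ordered triple of rows of `row : Fin s → Fin k → Fin 3`, not all
equal, hits `L ∪ {(1,2,3)}` in some column, then `s ≤ C(k, ⌊k/2⌋)`: the `3`-supports of the rows form an antichain of
`s` distinct subsets of the `k` columns. [folklore] -/
theorem card_le_choose_half_of_localUSP {s k : ℕ} {row : Fin s → Fin k → Fin 3}
    (hU : ∀ a b c : Fin s, (a ≠ b ∨ b ≠ c) → ∃ i : Fin k,
      (row a i, row b i, row c i) ∈ insert ((0 : Fin 3), (1 : Fin 3), (2 : Fin 3)) localStrongUSPPatterns) :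
    s ≤ k.choose (k / 2) := by
  classical
  -- the 3-support of a row
  let Z : Fin s → Finset (Fin k) := fun a => univ.filter fun j => row a j = 2
  -- key: for a ≠ c, Z c ⊄ Z a
  have key : ∀ a c : Fin s, a ≠ c → ¬ Z c ⊆ Z a := by
    intro a c hac hsub
    obtain ⟨i, hi⟩ := hU a a c (Or.inr hac)
    obtain ⟨hc2, ha2⟩ := localUSPPattern_eq_cases _ hi rfl
    simp only at hc2 ha2
    have hci : i ∈ Z c := by simp [Z, hc2]
    have hai : i ∈ Z a := hsub hci
    simp [Z] at hai
    exact ha2 hai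
  have hinj : Function.Injective Z := by
    intro a c h
    by_contra hac
    exact key a c hac (h ▸ subset_rfl)
  have hanti : IsAntichain (· ⊆ ·) (SetLike.coe (univ.image Z) : Set (Finset (Fin k))) := by
    intro X hX Y hY hne hsub
    simp only [SetLike.mem_coe, mem_image, mem_univ, true_and] at hX hY
    obtain ⟨a, rfl⟩ := hX
    obtain ⟨c, rfl⟩ := hY
    have hac : c ≠ a := fun h => hne (by rw [h])
    exact key c a hac hsub
  have hcard : (univ.image Z).card = s := by
    rw [card_image_of_injective _ hinj, card_univ, Fintype.card_fin]
  have := hanti.sperner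
  rw [hcard, Fintype.card_fin] at this
  exact this

/-- **Sperner ceiling for local strong USPs** (CKSU 2005 §6.1, tree `IsLocalStrongUSP`): a local strong USP of width
`k` has at most `C(k, ⌊k/2⌋)` rows. [folklore] -/
theorem IsLocalStrongUSP.card_le_choose_half {s k : ℕ} {row : Fin s → Fin k → Fin 3}
    (hU : IsLocalStrongUSP row) : s ≤ k.choose (k / 2) :=
  card_le_choose_half_of_localUSP fun a b c h => by
    obtain ⟨i, hi⟩ := hU a b c h
    exact ⟨i, mem_insert_of_mem hi⟩

end Summit.MatrixMultiplication.OmegaCensus
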